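import Literature.IUT.LogThetaLattice.PacketLogVolumesPrincipalPackets
import HarnessLib

/-!
# [IUTchIII] Proposition 3.9 (iii) for CAPSULES `A` with `|A| ≥ 1`: the `A`-labelled global log-volume,
# invariance under `(†𝕄⊛_mod)_α` for EACH label `α ∈ A` and under permutations of `A`, and the degree
# property "relative to a suitable normalization" (abc-iut cell, layer L6; divisor-level model)

S. Mochizuki, *Inter-universal Teichmüller theory III*, kurims manuscript (May 2020), §3, Proposition 3.9
(iii) "(Global Compatibility)", p. 117 [claim: Mochizuki2012, status: disputed]: "Write
`𝓘^ℚ(^A𝓕_{𝕍_ℚ}) = ∏_{v_ℚ ∈ 𝕍_ℚ} 𝓘^ℚ(^A𝓕_{v_ℚ})` … Then, by adding the log-volumes of (i) … at the various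
`v_ℚ ∈ 𝕍_ℚ`, one obtains a global log-volume `μ^log_{A,𝕍_ℚ} : 𝕄(𝓘^ℚ(^A𝓕_{𝕍_ℚ})) → ℝ` which is invariant with
respect to multiplication by elements of `(†𝕄⊛_mod)_α = (†𝕄⊛_MOD)_α ⊆ 𝓘^ℚ(^A𝓕_{𝕍_ℚ})` as well as with respect to
permutations of `A`, and, moreover, satisfies the following property concerning … objects `𝔍 = {𝔍_v}_{v∈𝕍}`
of `(†𝓕⊛_mod)_α` …: the global log-volume `μ^log_{A,𝕍_ℚ}(𝔍)` is equal to the degree of the arithmetic line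
bundle determined by `𝔍` …, relative to a suitable normalization."

`PacketLogVolumesPrincipalPackets.lean` (abc-iut-L6-d3, p408431) discharged these clauses for a SINGLE
label (`|A| = 1`). This file treats a general finite label set `A` (the capsule index set of
Proposition 3.9 (i)) at the same arithmetic-divisor level.

THE MODEL AND ITS NORMALISATION CONSTANT [MODELLING, derived here, not printed]: at `v_ℚ = p`, the
`A`-fold tensor packet `𝓘^ℚ(^A𝓕_{v_ℚ}) = ⊗_{α ∈ A} (⊕_{v | p} K_v)` (tensor product over `ℚ_p` of `|A|`
copies of the étale `ℚ_p`-algebra `R_p := ⊕_{v|p} K_v` of dimension `d := [F : ℚ] = Σ_{v|p} [K_v : ℚ_p]`)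
is a `ℚ_p`-vector space of dimension `d^{|A|}`. A region of the form `⊗_α 𝔞_α` with
`𝔞_α = ∏_{v|p} 𝔭_v^{-c_{α,v}} 𝒪_v = x_α · 𝒪_{R_p}` (`ord_v(x_{α,v}) = -c_{α,v}`) is the translate of the
integral structure `⊗_α 𝒪_{R_p}` [log-volume `0`, the packet-normalization of (i)] by the element
`x = ⊗_α x_α`, whose multiplication map on `R_p^{⊗A}` has determinant of `p`-adic absolute value
`∏_α |N_{R_p/ℚ_p}(x_α)|_p^{d^{|A|-1}}`; since a Haar measure on a `ℚ_p`-vector space scales by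
`|det|_p` under a linear automorphism, `μ^log_{A,v_ℚ}(⊗_α 𝔞_α) = d^{|A|-1} · Σ_α Σ_{v|p} c_{α,v}·log N(𝔭_v)`,
and likewise at `v_ℚ = ∞` with `R_∞ = ⊕_{w|∞} K_w`, `d = Σ_w [K_w : ℝ]`. Accordingly the `A`-CAPSULE
LOG-VOLUME of this file is

  `capsuleLogVolume F A v_ℚ c := d^{|A|-1} · Σ_{α ∈ A} packetDivisorLogVolume F v_ℚ (c α)`
  (`capsuleWeight F A = [F:ℚ]^{|A|-1}`; for `|A| = 1` it is the single-label volume, `capsuleLogVolume_unique`),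

on coordinates `c : A → (places over v_ℚ) → ℝ`; the global log-volume is abc-iut-L6-t4's `globalLogVolume`
("adding … at the various `v_ℚ`"). Multiplication by `f ∈ (†𝕄⊛_mod)_α` acts on the `α`-th tensor factor
only: `c_{α,v} ↦ c_{α,v} − ADiv(f)_v`, the other labels untouched (`capsulePrincipalAction α f`).

RESULTS: `globalLogVolume_capsuleRegionOf` (`μ^log_{A,𝕍_ℚ}(S_𝔞) = d^{|A|-1}·Σ_α deg_F(𝔞_α)`);
**`prop39iii_invariance_capsuleModel α : Prop39iii_invariance (capsuleLogVolume F A) (capsulePrincipalAction F A α)`**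
for EVERY label `α` (product formula, via abc-iut-L6-t5's `Prop39iii_invariance_of_productFormula` and
`finsum_packet_principal`); `capsuleLogVolume_perm` / `globalLogVolume_capsuleRegionOf_perm` (invariance
under permutations of `A`); **`prop39iii_degree_capsuleModel α : Prop39iii_degree (capsuleLogVolume F A)
(capsuleObjRegionOf F A α) (degF F)`** with the constant `c = d^{|A|-1} > 0` — the printed "relative to a
suitable normalization" made explicit: the region determined by `𝔍 ∈ (†𝓕⊛_mod)_α` (`𝔍` in the `α`-th
factor, integral structures in the others) has global log-volume `[F:ℚ]^{|A|-1} · deg_F(𝔍)`.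

Scope: divisor level (regions of product-of-fractional-ideals type); the measure-theoretic tensor packets
are campaign-S / abc-iut-c312-3 objects (`TensorPacketLogVolume`, `AdelicPacketModel`). Nothing here
constructs `(†𝓕⊛_mod)_α` or a Frobenioid, asserts anything about Cor. 3.12, or takes a side.
-/

noncomputable section

namespace Literature.IUT.LogThetaLattice

open Literature.IUT.LogVolume NumberField

universe u

variable (F : Type u) [Field F] [NumberField F] (A : Type) [Fintype A]

/-! ### The `A`-capsule log-volume at `v_ℚ` -/

/-- The normalisation constant `d^{|A|-1}`, `d = [F : ℚ]` (the exponent of the norm in the determinant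
of multiplication by `x ⊗ 1 ⊗ ⋯ ⊗ 1` on the `d^{|A|}`-dimensional tensor packet; see the module
docstring). [claim: Mochizuki2012, status: disputed] -/
def capsuleWeight : ℝ :=
  (Module.finrank ℚ F : ℝ) ^ (Fintype.card A - 1)

/-- `d^{|A|-1} > 0`. [claim: Mochizuki2012, status: disputed] -/
theorem capsuleWeight_pos : 0 < capsuleWeight F A := by
  unfold capsuleWeight
  have h : 0 < Module.finrank ℚ F := Module.finrank_pos
  positivity

/-- `d^{|A|-1} ≠ 0`. [claim: Mochizuki2012, status: disputed] -/
theorem capsuleWeight_ne_zero : capsuleWeight F A ≠ 0 :=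
  (capsuleWeight_pos F A).ne'

/-- **The `A`-capsule log-volume `μ^log_{A,v_ℚ}`** ([IUTchIII] Prop. 3.9 (i)/(iii), p. 116–117) at the
divisor level: for coordinates `c : A → {v | v_ℚ} → ℝ` (the region `⊗_α ∏_{v|v_ℚ} 𝔭_v^{-c_{α,v}}𝒪_v` of the
`A`-fold tensor packet), `μ^log_{A,v_ℚ}(c) = [F:ℚ]^{|A|-1} · Σ_α Σ_{v|v_ℚ} c_{α,v}·w_v`.
[claim: Mochizuki2012, status: disputed] -/
def capsuleLogVolume (q : RatPlace) (c : A → Packet F q → ℝ) : ℝ :=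
  capsuleWeight F A * ∑ α, packetDivisorLogVolume F q (c α)

/-- `|A| = 1`: the capsule log-volume is the single-label packet log-volume of
`PacketLogVolumesPrincipalPackets.lean`. [claim: Mochizuki2012, status: disputed] -/
theorem capsuleLogVolume_unique [Unique A] (q : RatPlace) (c : A → Packet F q → ℝ) :
    capsuleLogVolume F A q c = packetDivisorLogVolume F q (c default) := by
  simp [capsuleLogVolume, capsuleWeight, Fintype.card_unique]

/-- **"invariant … with respect to permutations of `A`"** (p. 117 l. 35), locally at `v_ℚ`: re-labelling the
factors by `σ ∈ 𝔖_A` does not change `μ^log_{A,v_ℚ}`. [claim: Mochizuki2012, status: disputed] -/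
theorem capsuleLogVolume_perm (q : RatPlace) (c : A → Packet F q → ℝ) (σ : Equiv.Perm A) :
    capsuleLogVolume F A q (fun α => c (σ α)) = capsuleLogVolume F A q c := by
  unfold capsuleLogVolume
  rw [Equiv.sum_comp σ (fun α => packetDivisorLogVolume F q (c α))]

/-- The capsule log-volume vanishes when every label's packet log-volume does.
[claim: Mochizuki2012, status: disputed] -/
theorem capsuleLogVolume_eq_zero {q : RatPlace} {c : A → Packet F q → ℝ}
    (h : ∀ α, packetDivisorLogVolume F q (c α) = 0) : capsuleLogVolume F A q c = 0 := by
  simp [capsuleLogVolume, h]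

/-! ### Regions from `A`-tuples of arithmetic divisors; "adding at the various `v_ℚ`" -/

/-- The region `S_𝔞 = ⊗_α ∏_v 𝔭_v^{-𝔞_α(v)}` of the global `A`-fold tensor packet determined by an `A`-tuple
of ℝ-arithmetic divisors (coordinates `c_{α,v} = 𝔞_α(v)`); only finitely many `v_ℚ` carry a nonzero
log-volume. [claim: Mochizuki2012, status: disputed] -/
def capsuleRegionOf (a : A → ADivisor F) : GlobalRegion (capsuleLogVolume F A) :=
  ⟨fun q α v => a α v.1, by
    refine (Set.finite_iUnion fun α : A => (packetRegionOf F (a α)).2).subset fun q hq => ?_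
    rw [Set.mem_iUnion]
    by_contra h
    push Not at h
    apply Function.mem_support.mp hq
    refine capsuleLogVolume_eq_zero F A fun α => ?_
    have hα := h α
    rw [Function.notMem_support] at hα
    exact hα⟩

/-- Coordinates of `S_𝔞`. [claim: Mochizuki2012, status: disputed] -/
@[simp] theorem capsuleRegionOf_apply (a : A → ADivisor F) (q : RatPlace) (α : A) (v : Packet F q) :
    (capsuleRegionOf F A a).1 q α v = a α v.1 := rfl

/-- **`μ^log_{A,𝕍_ℚ}(S_𝔞) = [F:ℚ]^{|A|-1} · Σ_α deg_F(𝔞_α)`** ("by adding the log-volumes … at the various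
`v_ℚ ∈ 𝕍_ℚ`", p. 117, then regrouping `Σ_{v_ℚ} Σ_{v|v_ℚ} = Σ_v` label by label).
[claim: Mochizuki2012, status: disputed] -/
theorem globalLogVolume_capsuleRegionOf (a : A → ADivisor F) :
    globalLogVolume (capsuleLogVolume F A) (capsuleRegionOf F A a) =
      capsuleWeight F A * ∑ α, degF F (a α) := by
  rw [globalLogVolume]
  change ∑ᶠ q, capsuleWeight F A * ∑ α, packetDivisorLogVolume F q ((packetRegionOf F (a α)).1 q) = _
  rw [← mul_finsum' _ _ ?_]
  · congr 1
    rw [finsum_sum_comm _ _ fun α _ => (packetRegionOf F (a α)).2]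
    exact Finset.sum_congr rfl fun α _ => globalLogVolume_packetRegionOf F (a α)
  · refine (Set.finite_iUnion fun α : A => (packetRegionOf F (a α)).2).subset fun q hq => ?_
    rw [Set.mem_iUnion]
    by_contra h
    push Not at h
    apply Function.mem_support.mp hq
    refine Finset.sum_eq_zero fun α _ => ?_
    have hα := h α
    rwa [Function.notMem_support] at hα

/-- **"invariant … with respect to permutations of `A`"**, globally: `μ^log_{A,𝕍_ℚ}(S_{𝔞∘σ}) = μ^log_{A,𝕍_ℚ}(S_𝔞)`.
[claim: Mochizuki2012, status: disputed] -/
theorem globalLogVolume_capsuleRegionOf_perm (a : A → ADivisor F) (σ : Equiv.Perm A) :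
    globalLogVolume (capsuleLogVolume F A) (capsuleRegionOf F A (fun α => a (σ α))) =
      globalLogVolume (capsuleLogVolume F A) (capsuleRegionOf F A a) := by
  rw [globalLogVolume_capsuleRegionOf, globalLogVolume_capsuleRegionOf,
    Equiv.sum_comp σ (fun α => degF F (a α))]

/-- **The product formula, capsule form**: `Σ_{v_ℚ} (−[F:ℚ]^{|A|-1} · Σ_{v|v_ℚ} ADiv(f)_v·w_v) = 0`
(abc-iut-L6-d3 `finsum_packet_principal`, i.e. abc-iut-L6-t16 `degF_principal`). [folklore] -/
private theorem finsum_capsule_principal (f : F) :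
    ∑ᶠ q, -(capsuleWeight F A *
      packetDivisorLogVolume F q ((packetRegionOf F (ADivisor.principal f)).1 q)) = 0 := by
  rw [finsum_neg_distrib, ← mul_finsum' _ _ (packetRegionOf F (ADivisor.principal f)).2,
    finsum_packet_principal, mul_zero, neg_zero]

/-- The local correction terms are supported on finitely many `v_ℚ`. [folklore] -/
private theorem finite_support_capsule_principal (f : F) :
    (Function.support fun q => -(capsuleWeight F A *
      packetDivisorLogVolume F q ((packetRegionOf F (ADivisor.principal f)).1 q))).Finite := by
  refine (packetRegionOf F (ADivisor.principal f)).2.subset fun q hq => ?_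
  exact Function.mem_support.mpr (right_ne_zero_of_mul (neg_ne_zero.mp (Function.mem_support.mp hq)))

/-! ### Multiplication by `(†𝕄⊛_mod)_α`: the `α`-th factor only; the product formula -/

variable [DecidableEq A]

/-- **Multiplication by `f ∈ (†𝕄⊛_mod)_α`** (p. 117 l. 31–34): `f` acts on the `α`-labelled tensor factor,
shifting the coordinates `c_{α,v} ↦ c_{α,v} − ADiv(f)_v` and leaving the labels `β ≠ α` untouched.
[claim: Mochizuki2012, status: disputed] -/
def capsulePrincipalAction (α : A) (f : Fˣ) (S : GlobalRegion (capsuleLogVolume F A)) :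
    GlobalRegion (capsuleLogVolume F A) :=
  ⟨fun q β v => S.1 q β v - if β = α then ADivisor.principal (f : F) v.1 else 0, by
    have h1 := S.2
    have h2 := (packetRegionOf F (ADivisor.principal (f : F))).2
    refine (h1.union h2).subset fun q hq => ?_
    by_contra hq'
    rw [Set.mem_union, not_or, Function.notMem_support, Function.notMem_support] at hq'
    apply Function.mem_support.mp hq
    change capsuleWeight F A * ∑ β, packetDivisorLogVolume F q
      (fun v => S.1 q β v - if β = α then ADivisor.principal (f : F) v.1 else 0) = 0
    have hβ : ∀ β, packetDivisorLogVolume F q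
        (fun v => S.1 q β v - if β = α then ADivisor.principal (f : F) v.1 else 0) =
        packetDivisorLogVolume F q (S.1 q β) -
          if β = α then packetDivisorLogVolume F q ((packetRegionOf F (ADivisor.principal (f : F))).1 q)
          else 0 := by
      intro β
      rw [packetDivisorLogVolume_sub]
      split_ifs with h
      · rfl
      · rw [packetDivisorLogVolume_eq_zero F fun _ => rfl]
    simp_rw [hβ, Finset.sum_sub_distrib, Finset.sum_ite_eq', Finset.mem_univ, if_true, hq'.2, sub_zero]
    have h0 : capsuleWeight F A * ∑ β, packetDivisorLogVolume F q (S.1 q β) = 0 := hq'.1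
    exact h0⟩

/-- Coordinates after multiplication by `f ∈ (†𝕄⊛_mod)_α`. [claim: Mochizuki2012, status: disputed] -/
@[simp] theorem capsulePrincipalAction_apply (α : A) (f : Fˣ) (S : GlobalRegion (capsuleLogVolume F A))
    (q : RatPlace) (β : A) (v : Packet F q) :
    (capsulePrincipalAction F A α f S).1 q β v =
      S.1 q β v - if β = α then ADivisor.principal (f : F) v.1 else 0 := rfl

/-- The local change of `μ^log_{A,v_ℚ}` under `f ∈ (†𝕄⊛_mod)_α`: `−[F:ℚ]^{|A|-1} · Σ_{v|v_ℚ} ADiv(f)_v·w_v`,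
the same for every region. [claim: Mochizuki2012, status: disputed] -/
theorem capsuleLogVolume_capsulePrincipalAction (α : A) (f : Fˣ)
    (S : GlobalRegion (capsuleLogVolume F A)) (q : RatPlace) :
    capsuleLogVolume F A q ((capsulePrincipalAction F A α f S).1 q) =
      capsuleLogVolume F A q (S.1 q) +
        -(capsuleWeight F A *
          packetDivisorLogVolume F q ((packetRegionOf F (ADivisor.principal (f : F))).1 q)) := by
  change capsuleWeight F A * ∑ β, packetDivisorLogVolume F q
      (fun v => S.1 q β v - if β = α then ADivisor.principal (f : F) v.1 else 0) = _
  have hβ : ∀ β, packetDivisorLogVolume F q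
      (fun v => S.1 q β v - if β = α then ADivisor.principal (f : F) v.1 else 0) =
      packetDivisorLogVolume F q (S.1 q β) -
        if β = α then packetDivisorLogVolume F q ((packetRegionOf F (ADivisor.principal (f : F))).1 q)
        else 0 := by
    intro β
    rw [packetDivisorLogVolume_sub]
    split_ifs with h
    · rfl
    · rw [packetDivisorLogVolume_eq_zero F fun _ => rfl]
  simp_rw [hβ, Finset.sum_sub_distrib, Finset.sum_ite_eq', Finset.mem_univ, if_true]
  unfold capsuleLogVolume
  ring

/-- **IUTchIII:Prop3.9(iii) for capsules — "`μ^log_{A,𝕍_ℚ}` is invariant with respect to multiplication by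
elements of `(†𝕄⊛_mod)_α`", for EVERY label `α ∈ A`**: abc-iut-L6-t4's `Prop39iii_invariance` for the
`A`-capsule log-volume and the action on the `α`-th factor, via abc-iut-L6-t5's product-formula reduction.
[claim: Mochizuki2012, status: disputed] -/
theorem prop39iii_invariance_capsuleModel (α : A) :
    Prop39iii_invariance (capsuleLogVolume F A) (capsulePrincipalAction F A α) :=
  Prop39iii_invariance_of_productFormula (capsuleLogVolume F A) (capsulePrincipalAction F A α)
    (fun f q => -(capsuleWeight F A *
      packetDivisorLogVolume F q ((packetRegionOf F (ADivisor.principal (f : F))).1 q)))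
    (fun f => finite_support_capsule_principal F A (f : F))
    (fun f => finsum_capsule_principal F A (f : F))
    (fun f S q => capsuleLogVolume_capsulePrincipalAction F A α f S q)

/-- Pointwise form: `μ^log_{A,𝕍_ℚ}(f ·_α S) = μ^log_{A,𝕍_ℚ}(S)`. [claim: Mochizuki2012, status: disputed] -/
theorem globalLogVolume_capsulePrincipalAction (α : A) (f : Fˣ)
    (S : GlobalRegion (capsuleLogVolume F A)) :
    globalLogVolume (capsuleLogVolume F A) (capsulePrincipalAction F A α f S) =
      globalLogVolume (capsuleLogVolume F A) S :=
  prop39iii_invariance_capsuleModel F A α f S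

/-! ### The degree property "relative to a suitable normalization" -/

/-- The region of the `A`-fold tensor packet determined by an object `𝔍 ∈ (†𝓕⊛_mod)_α`: the divisor of
`𝔍` in the `α`-th factor, the integral structures in the factors `β ≠ α` (p. 117 l. 36–38 "objects
`𝔍 = {𝔍_v}` of `(†𝓕⊛_mod)_α`"). [claim: Mochizuki2012, status: disputed] -/
def capsuleObjRegionOf (α : A) (a : ADivisor F) : GlobalRegion (capsuleLogVolume F A) :=
  capsuleRegionOf F A (Pi.single α a)

/-- `μ^log_{A,𝕍_ℚ}` of the region of `𝔍 ∈ (†𝓕⊛_mod)_α`: `[F:ℚ]^{|A|-1} · deg_F(𝔍)`.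
[claim: Mochizuki2012, status: disputed] -/
theorem globalLogVolume_capsuleObjRegionOf (α : A) (a : ADivisor F) :
    globalLogVolume (capsuleLogVolume F A) (capsuleObjRegionOf F A α a) =
      capsuleWeight F A * degF F a := by
  rw [capsuleObjRegionOf, globalLogVolume_capsuleRegionOf]
  congr 1
  rw [Finset.sum_eq_single α (fun β _ hβ => by rw [Pi.single_eq_of_ne hβ, map_zero])
    (fun h => absurd (Finset.mem_univ α) h), Pi.single_eq_same]

/-- **IUTchIII:Prop3.9(iii) for capsules — "the global log-volume `μ^log_{A,𝕍_ℚ}(𝔍)` is equal to the degree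
of the arithmetic line bundle determined by `𝔍` … relative to a suitable normalization"**: abc-iut-L6-t4's
`Prop39iii_degree` holds for the `A`-capsule log-volume, the regions of objects of `(†𝓕⊛_mod)_α` and
`deg_F`, with the normalisation constant `c = [F:ℚ]^{|A|-1} > 0` made explicit.
[claim: Mochizuki2012, status: disputed] -/
theorem prop39iii_degree_capsuleModel (α : A) :
    Prop39iii_degree (capsuleLogVolume F A) (capsuleObjRegionOf F A α) (degF F) :=
  ⟨capsuleWeight F A, capsuleWeight_pos F A, fun a => globalLogVolume_capsuleObjRegionOf F A α a⟩

/-- Multiplication by `f ∈ (†𝕄⊛_mod)_α` carries the region of `𝔍 ∈ (†𝓕⊛_mod)_α` to the region of `f · 𝔍`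
(divisor `𝔞 − ADiv(f)` in the `α`-th factor). [claim: Mochizuki2012, status: disputed] -/
theorem capsulePrincipalAction_capsuleObjRegionOf (α : A) (f : Fˣ) (a : ADivisor F) :
    capsulePrincipalAction F A α f (capsuleObjRegionOf F A α a) =
      capsuleObjRegionOf F A α (a - ADivisor.principal (f : F)) := by
  apply Subtype.ext
  funext q β v
  simp only [capsulePrincipalAction_apply, capsuleObjRegionOf, capsuleRegionOf_apply]
  by_cases h : β = α
  · subst h
    simp
  · simp [h]

/-- NON-VACUITY: the action of `(†𝕄⊛_mod)_α` is not trivial — if `ADiv(f)_v ≠ 0` at some place then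
`f ·_α S ≠ S` for every region `S`. [claim: Mochizuki2012, status: disputed] -/
theorem capsulePrincipalAction_ne_self (α : A) {f : Fˣ} {v : Place F}
    (hv : ADivisor.principal (f : F) v ≠ 0) (S : GlobalRegion (capsuleLogVolume F A)) :
    capsulePrincipalAction F A α f S ≠ S := by
  intro h
  have h' := congrArg (fun T : GlobalRegion (capsuleLogVolume F A) => T.1 (ratPlaceBelow F v) α
    (Packet.ofPlace F v)) h
  simp only [capsulePrincipalAction_apply, if_true] at h'
  exact hv (sub_eq_self.mp h')

end Literature.IUT.LogThetaLattice
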